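import Summits.QuantumFields.YangMills.Theorems.BalabanUVNodesN22KernelLimitOfTwoPointGenerating
import Summits.QuantumFields.YangMills.Theorems.BalabanUVNodesN22AtKernelsOfActivitySlotsClosed
import Literature.MathematicalPhysics.QuantumFieldTheory.Balaban1983to89.Node00.RateRecordW1Reading

/-!
# NODE N22 (NE9) — THE (1.21)-EXISTENCE LETTERS KEYED ON THE VALUE-LEVEL LAW (G≈): W1-19b's `PolLimitsExist` ∕ `PolLimitsExistOfRecord₁₃` from W1's activity-level value slot,
# the complexified readings, the p. 282 tails and the cross-volume closeness of the small-domain two-point generating functions; A6 at def-W1's termless tower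

Cell `pub-ymgap`, Track A (HUMAN RULING D-0062), WIDTH SEAT `dag-n22-w3` g4 on node n22 = NE9; `--kind proof --supports stmt-QuantumFields-20544 --as helper` (K3⁷
`SpineGivenEndpointR13SepCoPH`, skeleton v5 941dddb108cbaacf), COUNT-NEUTRAL.  Second file of CLAIM-1 of this seat (pub-ymgap INBOX l.31303; split for the 400-line rule) over the
schema file `…N22KernelLimitOfTwoPointGenerating` (§0 `fderiv_fderiv_eq_polTensor_twoPoint`, §1 `sum_polComp_eq_polTensor_twoPointGenerating` ∕ `differentiableOn_twoPointGenerating` ∕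
`sum_polScalar_eq_avg_polTensor_twoPointGenerating` ∕ `abs_avg_polTensor_twoPoint_sub_le`, §2 ★★ `approxStable_of_twoPointGenerating` = (G≈) ⟹ (S≈)).

* §3 ★★★ `polLimitsExist_localizedSum_of_twoPointGenerating` — this seat's g3 `polLimitsExist_localizedSum_of_activitySlots` (p607522 §1) with its one structural law (S≈) (kernel level)
  REPLACED by the value-level law (G≈): «for `g ∈ W`, a level `k` and `(μ, ν, z)`, from a threshold on and for every colour `c`, the small-domain two-point complex generating functions
  `σ ↦ Σ_{X ∈ lo k K} E^{(k+1)}_X(hist; Φ_{K,X}(σ₀·ι_{K,X}e_{μ,z,c} + σ₁·ι_{K,X}e_{ν,0,c}))` at run lengths `K + 1`, `K` differ by `≤ C r₀^K` on the bidisc `‖σ‖ < r₂`, `(2B₃ + 1) r₂ ≤ r`»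
  ([I] p. 264 «we take a limit of these functions as T^{(j+1)} ↗ Z^d»); ★★★ `polLimitsExistOfRecord₁₃_of_twoPointGenerating` — the record edition under W1-20's law
  `Localizes17OfRecord₁₃ F N θ S emb` (p607522 §2 likewise): the `hlim` ∕ `hL` slot of this seat's (1.21) passages (`…N22AtU3OfKernels`, `…N22AtKernelsOfActivitySlotsClosed`) and of
  dag-n27-w1's letters-level composer, now keyed on (G≈).  The N22At ∕ ReadOut row sentences of p611742 with (S≈) ↦ (G≈) are ONE application of `approxStable_of_twoPointGenerating`
  each (left to a sequel on the built olean).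
* §5 ★★★ `n22At_rateCarriers_of_kernels_pin_of_activitySlots_of_twoPointGenerating` ∕ ★★★ `readOutAt_rateCarriers_of_kernels_pin_of_activitySlots_of_twoPointGenerating` — THE ROW
  SENTENCES of this seat's g3 `…N22AtKernelsOfActivitySlotsClosed` (p611742: `N22At (rateCarriersOfRecord₁₃CoPH 𝔯 F θ hP g₀ os k).u3` and the (D4) read-out face, every run length, at a
  kernel-PINNED reading of record = K3⁷ v5 §2b `n22At_rrOfRecord_of_pinned` ∕ `readOutAt_rrOfRecord_of_pinned` at the selector's value) with (S≈) ↦ (G≈), one application of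
  `approxStable_of_twoPointGenerating` each.
* §4 A6 (director-ym №189) `polLimitsExist_localizedSum_of_twoPointGenerating_fires_zeroTower` — every hypothesis of §3 inhabited AT ONCE by def-W1's TERMLESS towers
  `W1.termlessTower` (`H ≡ 0`, hence every (2.13) term `E ≡ 0`, `W1.E_termlessTower`) at the zero chart `ρ = 0`, (G≈) with `C := 0` — DEGENERATE, declared.  The non-degenerate
  rung for the existence half needs cross-volume-coherent model towers (an identification of the small domains of the tori `K`, `K + 1` near the window) which the tree does not
  have; said, not hidden.

CONSUMES BY NAME (nothing re-declared): the schema file above; p607522 `polLimitsExist_localizedSum_of_activitySlots` ∕ `kappa_four_smoke`; p611742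
`n22At_rateCarriers_of_kernels_pin_of_activitySlots_of_approxStable` ∕ `readOutAt_rateCarriers_of_kernels_pin_of_activitySlots_of_approxStable` ∕ `numerals_of_doubled` (dag-n22-w2 (B) p606885
and dag-n27-w1 p591653 inside); node00-def-W1 W1-19b
`PolLimitsExist` ∕ `PolLimitsExistOfRecord₁₃` ∕ `polLimitsExistOfRecord₁₃_iff_of_localizes` (p595370), W1-20 `localizedSum` ∕ `Localizes17OfRecord₁₃` (p592608), W1-12
`termlessTower` ∕ `H_termlessTower` ∕ `E_termlessTower` (`Node00/RateRecordW1Reading`).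

HONEST FRAMING (binding).  Count-neutral helper; THEOREMS ONLY (0 def, 0 sorry, standard axioms); two compositions and one degenerate model witness.  Every estimate of Bałaban's
STAYS A DISPLAYED HYPOTHESIS with its owner: W1's (2.38) value slot at the towers of record (N10's Lemma 3 T-row ∕ NODE A), activity holomorphy through the complexified minimizer
reading and the reading itself ([I] p. 264, [II] p. 15 — NODE A), the p. 282 site-weight tails (NODE A), (G≈) (NODE A ∕ def-W1: thermodynamic convergence near the window of the local
terms' generating functions — the content of [I] p. 264 «this limit exists by (1.7)»), W1-20's law `Localizes17OfRecord₁₃` (NODE A ∕ N10), Road-1 numerals.  (1.21)'s existence for the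
terms OF RECORD is NOT proved; nothing of Bałaban's is constructed or asserted; no inhabitant at the datum of record; N22 NOT discharged (typed 28∕28 · discharged 5∕27 UNMOVED); K3⁷
OPEN, NOT claimed; no count claim (the chair's single count line is the only count); one finite 𝕋⁴ programme at fixed ε — R4 closes the CONDITIONAL rung `BalabanLadder.UV` only;
NOTHING about the continuum limit, ℝ⁴, infinite volume, OS axioms, a mass gap or the Clay problem is proved or claimed by any of this.  No decl carries a cite tag (Summit side); TYPES
only: [I] = [Balaban1987RG1] (1.7) p. 261, (1.18) p. 263, (1.20)–(1.21) p. 264, p. 282; [II] = [Balaban1988RG2Cluster] (2.11), (2.13)–(2.14) pp. 14–15, Lemma 3 (2.38) p. 20.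
-/

noncomputable section

open Filter Topology Metric Set
open scoped BigOperators

namespace YMDAG.N22.AtKernels

open Literature.MathematicalPhysics.QuantumFieldTheory.Balaban1983to89
open Literature.MathematicalPhysics.QuantumFieldTheory.Balaban1983to89.T4Continuum (T4Family ULoop)
open Literature.MathematicalPhysics.QuantumFieldTheory.Balaban1983to89.T4OutputRate (Window)
open Literature.MathematicalPhysics.QuantumFieldTheory.Balaban1983to89.B12PolarizationTensor120 (polTensor polComp expChart)
open Literature.MathematicalPhysics.QuantumFieldTheory.Balaban1983to89.Node00 (polScalar polWindow siteOfInt PolLimitExists Stage13Params Stage13HParams U3Letters₁₁ MatA datumOfRecord₁₃CoPH)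
open Literature.MathematicalPhysics.QuantumFieldTheory.Balaban1983to89.Node00.Sect2 (domCount domSys CPair)
open Literature.MathematicalPhysics.QuantumFieldTheory.Balaban1983to89.Node00.W1 (ClusterTower ClusterStep termlessTower H_termlessTower E_termlessTower)
open Literature.MathematicalPhysics.QuantumFieldTheory.Balaban1983to89.Node00.LocalizedSum17 (localizedSum ReadingMaps Localizes17OfRecord₁₃)
open Literature.MathematicalPhysics.QuantumFieldTheory.Balaban1983to89.Node00.U3OfKernels (histPrefix objectsOfRecord₁₃)
open Literature.MathematicalPhysics.QuantumFieldTheory.Balaban1983to89.Node00.U3KernelLetters (PolLimitsExist PolLimitsExistOfRecord₁₃ polLimitsExistOfRecord₁₃_iff_of_localizes)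
open Literature.MathematicalPhysics.QuantumFieldTheory.Balaban1983to89.B12Decay510Torus (distCT nearT distCT_nonneg)
open Literature.MathematicalPhysics.QuantumFieldTheory.Balaban1983to89.B12TreeDecay (K₀ kappa₀ K₀_pos kappa₀_nonneg)
open Literature.MathematicalPhysics.QuantumFieldTheory.Balaban1983to89.TreeLengthTorus (TPt torusTreeLen torusTreeLen_nonneg)
open Literature.MathematicalPhysics.QuantumFieldTheory.Balaban1983to89.B12Decay510 (delta1)
open Literature.MathematicalPhysics.QuantumFieldTheory.Balaban1983to89.B12Decay510Window (K₁)
open Literature.MathematicalPhysics.QuantumFieldTheory.Balaban1983to89.B12Sec2to5 (betaPrime510)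
open YMDAG.UVSplit (N22At ReadOutAt u3OfRecord₁₃ RateReading₁₃CoPH rateCarriersOfRecord₁₃CoPH)

/-! ## §3 The (1.21)-existence letter from the activity slots + (G≈): p607522 §1∕§2 with (S≈) ↦ (G≈) -/

section Existence

variable {𝔄 : Type*} [NormedRing 𝔄] [NormedAlgebra ℝ 𝔄] {𝔸 : Type*}
variable {V : Type*} [NormedAddCommGroup V] [NormedSpace ℝ V] {ι : Type*} [Fintype ι]
variable (F : T4Family)

open Classical in
/-- ★★★ **THE (1.21)-EXISTENCE LETTER OF THE (1.7) LOCALIZED SUM FROM W1's ACTIVITY-LEVEL VALUE SLOT + THE VALUE-LEVEL LAW (G≈).**  `polLimitsExist_localizedSum_of_activitySlots` (p607522 §1)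
with its one structural law (S≈) REPLACED by (G≈) — cross-volume geometric closeness, on the fixed bidisc `‖σ‖ < r₂` (`0 < r₂`, `(2B₃ + 1) r₂ ≤ r`), of the small-domain two-point complex
generating functions (§2 `approxStable_of_twoPointGenerating` supplies (S≈); everything else — W1's (2.38) value slot with Road-1 numerals, the complexified readings with chart∕space clauses and
activity holomorphy, the p. 282 tails, `M = L^{m′}`, the small∕near class with its threshold clause — is passed through).  Conclusion: W1-19b's `PolLimitsExist F (localizedSum F S emb) ρ bV W`.
[cite: Balaban1987RG1, (1.7) p.261, (1.20)-(1.21) p.264, p.282; Balaban1988RG2Cluster, (2.13)-(2.14) pp.14-15, (2.38) p.20] -/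
theorem polLimitsExist_localizedSum_of_twoPointGenerating (m' : ℕ) (M : ℕ) [NeZero M] (hM : M = F.L ^ m')
    (S : (K : ℕ) → ClusterTower (F.P K) 𝔸 M) (emb : ReadingMaps F 𝔄 𝔸) (ρ : V →L[ℝ] 𝔄) (bV : Module.Basis ι ℝ V) (W : Set (ℕ → ℝ))
    (Wk : (K k : ℕ) → Set (Fin (k + 1) → ℝ)) (hWk : ∀ g ∈ W, ∀ K k, histPrefix g k ∈ Wk K k)
    (sp : (K k : ℕ) → (domSys (F.P K) M (k + 1)).Dom → Set (CPair (F.P K) 𝔸)) {A R r₁ κ B₃ δ₀ r r₂ r₀ : ℝ}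
    (hA : 0 ≤ A) (hr₁ : 0 ≤ r₁) (hκ0 : 0 < κ) (hκ : κ ≤ r₁) (hκ4 : kappa₀ (4 * 2 ^ 4) (2 * 4) ≤ κ / 2 / 2) (hrate : r₁ + 2 * (64 * Real.log 162) + 2 ≤ R)
    (hsmall : A * Real.exp (5 * r₁ + 1) * K₀ 64 8 * 9 * 64 ≤ 1) (hB₃ : 0 ≤ B₃) (hδ₀ : 0 < δ₀) (hr : 0 < r)
    (h238 : ∀ K k, ((S K) k).Bound238 (Wk K k) (sp K k) A R)
    (Ec : ℕ → ℕ → Type*) [∀ K k, NormedAddCommGroup (Ec K k)] [∀ K k, NormedSpace ℂ (Ec K k)]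
    (ιc : (K k : ℕ) → (domSys (F.P K) M (k + 1)).Dom → ((Fin (F.P K).d → Site (F.P K) (k + 1) → V) →L[ℝ] Ec K k))
    (Φ : (K k : ℕ) → (domSys (F.P K) M (k + 1)).Dom → Ec K k → CPair (F.P K) 𝔸)
    (U : (K k : ℕ) → (domSys (F.P K) M (k + 1)).Dom → Set (Ec K k)) (hU : ∀ K k X, IsOpen (U K k X)) (hrU : ∀ K k X, ball (0 : Ec K k) r ⊆ U K k X)
    (hHhol : ∀ K k, ∀ hist ∈ Wk K k, ∀ (X Z : (domSys (F.P K) M (k + 1)).Dom), Z.1 ⊆ X.1 →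
      DifferentiableOn ℂ (fun z => ((S K) k).H hist (Φ K k X z) Z) (U K k X))
    (hΦemb : ∀ K k X (B : Fin (F.P K).d → Site (F.P K) (k + 1) → V), Φ K k X (ιc K k X B) = emb K k (fun l t => NormedSpace.exp (ρ (B l t))))
    (hΦsp : ∀ K k X, ∀ z ∈ U K k X, ∀ Z : (domSys (F.P K) M (k + 1)).Dom, Z.1 ⊆ X.1 → Φ K k X z ∈ sp K k Z)
    (w : (K k : ℕ) → (domSys (F.P K) M (k + 1)).Dom → Site (F.P K) (k + 1) → ℝ) (hw₀ : ∀ K k X t, 0 ≤ w K k X t)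
    (hw : ∀ K k X (l : Fin (F.P K).d) (t : Site (F.P K) (k + 1)) (c : ι), ‖ιc K k X (Pi.single l (Pi.single t (bV c)))‖ ≤ w K k X t)
    (hwB : ∀ K k (X : (domSys (F.P K) M (k + 1)).Dom) (t : Site (F.P K) (k + 1)),
      w K k X t ≤ B₃ * Real.exp (-δ₀ * distCT (domCount (F.P K) M (k + 1)) M (fun i => (ZMod.cast (t i) : ZMod (domCount (F.P K) M (k + 1) * M)))
        (nearT (M := M) (fun i => (ZMod.cast (t i) : ZMod (domCount (F.P K) M (k + 1) * M))) X)))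
    (lo : (k K : ℕ) → (domSys (F.P K) M (k + 1)).Dom → Prop) [∀ k K, DecidablePred (lo k K)]
    (hlo : ∀ (k K : ℕ) (X : (domSys (F.P K) M (k + 1)).Dom), ¬ lo k K X →
      let e : Site (F.P K) (k + 1) → TPt 4 (domCount (F.P K) M (k + 1) * M) := fun x i => (ZMod.cast (x i) : ZMod (domCount (F.P K) M (k + 1) * M))
      (K : ℝ) ≤ torusTreeLen X.1 ∨ (K : ℝ) ≤ distCT (domCount (F.P K) M (k + 1)) M (e (siteOfInt F K (k + 1) 0)) (nearT (M := M) (e (siteOfInt F K (k + 1) 0)) X))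
    (hr₀ : r₀ < 1) (hr₀' : 0 ≤ r₀) (hr₂ : 0 < r₂) (hr₂r : (2 * B₃ + 1) * r₂ ≤ r)
    (hG : ∀ g ∈ W, ∀ (k : ℕ) (μ ν : Fin 4) (z : Fin 4 → ℤ), ∃ (K₀ : ℕ) (C : ℝ), ∀ K : ℕ, K₀ ≤ K → ∀ (c : ι) (σ : Fin 2 → ℂ), ‖σ‖ < r₂ →
      ‖∑ X ∈ Finset.univ.filter (lo k (K + 1)), ((S (K + 1)) k).E (histPrefix g k) (Φ (K + 1) k X
          (σ 0 • ιc (K + 1) k X (Pi.single (Fin.cast (F.P_d (K + 1)).symm μ) (Pi.single (siteOfInt F (K + 1) (k + 1) z) (bV c))) +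
           σ 1 • ιc (K + 1) k X (Pi.single (Fin.cast (F.P_d (K + 1)).symm ν) (Pi.single (siteOfInt F (K + 1) (k + 1) 0) (bV c))))) X -
        ∑ X ∈ Finset.univ.filter (lo k K), ((S K) k).E (histPrefix g k) (Φ K k X
          (σ 0 • ιc K k X (Pi.single (Fin.cast (F.P_d K).symm μ) (Pi.single (siteOfInt F K (k + 1) z) (bV c))) +
           σ 1 • ιc K k X (Pi.single (Fin.cast (F.P_d K).symm ν) (Pi.single (siteOfInt F K (k + 1) 0) (bV c))))) X‖ ≤ C * r₀ ^ K) :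
    PolLimitsExist F (localizedSum F S emb) ρ bV W :=
  polLimitsExist_localizedSum_of_activitySlots F m' M hM S emb ρ bV W Wk hWk sp hA hr₁ hκ0 hκ hκ4 hrate hsmall hB₃ hδ₀ hr h238 Ec ιc Φ U hU hrU hHhol hΦemb hΦsp
    w hw₀ hw hwB lo hlo hr₀ hr₀'
    (approxStable_of_twoPointGenerating F M S emb ρ bV W Wk hWk sp hA hr₁ hrate hsmall hB₃ hδ₀ hr h238 Ec ιc Φ U hU hrU hHhol hΦemb hΦsp w hw hwB lo hr₂ hr₂r hr₀' hG)

end Existence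

section Record

open scoped Matrix.Norms.L2Operator

variable (F : T4Family) (N : ℕ) [NeZero N] {𝔸 : Type*} {M : ℕ} [NeZero M]

open Classical in
/-- ★★★ **THE (1.21)-EXISTENCE LETTER OF RECORD FROM W1's ACTIVITY-LEVEL VALUE SLOT + (G≈) AT A LOCALIZING READING** (LOCATED; p607522 §2 with (S≈) ↦ (G≈)).  For towers `S` (cube side
`M = L^{m′}`) read through `emb` which LOCALIZE the merged term family of record (W1-20's displayed law `Localizes17OfRecord₁₃ F N θ S emb` — NODE A ∕ N10's), the hypotheses of
`polLimitsExist_localizedSum_of_twoPointGenerating` at the record's β-chart `θ.ρ8 ∕ θ.bV` on the window `]0, θ.γ]^ℕ` give W1-19b's `PolLimitsExistOfRecord₁₃ F N θ` — the `hlim` ∕ `hL` slot of this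
seat's (1.21) passages and of dag-n27-w1's letters-level composer.  Nothing of the record is claimed to meet the hypotheses; (1.21)'s existence for the terms OF RECORD is NOT thereby proved —
it is REDUCED to «activity slot + reading + tails + (G≈) + law». [cite: Balaban1987RG1, (1.7) p.261, (1.20)-(1.21) p.264, p.282; Balaban1988RG2Cluster, (2.13)-(2.14) pp.14-15, (2.38) p.20] -/
theorem polLimitsExistOfRecord₁₃_of_twoPointGenerating (θ : Stage13Params F N) (m' : ℕ) (hM : M = F.L ^ m')
    (S : (K : ℕ) → ClusterTower (F.P K) 𝔸 M) (emb : ReadingMaps F (MatA N) 𝔸) (hloc : Localizes17OfRecord₁₃ F N θ S emb)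
    (Wk : (K k : ℕ) → Set (Fin (k + 1) → ℝ)) (hWk : ∀ g ∈ Window θ.γ, ∀ K k, histPrefix g k ∈ Wk K k)
    (sp : (K k : ℕ) → (domSys (F.P K) M (k + 1)).Dom → Set (CPair (F.P K) 𝔸)) {A R r₁ κ B₃ δ₀ r r₂ r₀ : ℝ}
    (hA : 0 ≤ A) (hr₁ : 0 ≤ r₁) (hκ0 : 0 < κ) (hκ : κ ≤ r₁) (hκ4 : kappa₀ (4 * 2 ^ 4) (2 * 4) ≤ κ / 2 / 2) (hrate : r₁ + 2 * (64 * Real.log 162) + 2 ≤ R)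
    (hsmall : A * Real.exp (5 * r₁ + 1) * K₀ 64 8 * 9 * 64 ≤ 1) (hB₃ : 0 ≤ B₃) (hδ₀ : 0 < δ₀) (hr : 0 < r)
    (h238 : ∀ K k, ((S K) k).Bound238 (Wk K k) (sp K k) A R)
    (Ec : ℕ → ℕ → Type*) [∀ K k, NormedAddCommGroup (Ec K k)] [∀ K k, NormedSpace ℂ (Ec K k)]
    (ιc : letI := θ.instVβ₁; letI := θ.instVβ₂; letI := θ.instιβ
      (K k : ℕ) → (domSys (F.P K) M (k + 1)).Dom → ((Fin (F.P K).d → Site (F.P K) (k + 1) → θ.Vβ) →L[ℝ] Ec K k))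
    (Φ : (K k : ℕ) → (domSys (F.P K) M (k + 1)).Dom → Ec K k → CPair (F.P K) 𝔸)
    (U : (K k : ℕ) → (domSys (F.P K) M (k + 1)).Dom → Set (Ec K k)) (hU : ∀ K k X, IsOpen (U K k X)) (hrU : ∀ K k X, ball (0 : Ec K k) r ⊆ U K k X)
    (hHhol : ∀ K k, ∀ hist ∈ Wk K k, ∀ (X Z : (domSys (F.P K) M (k + 1)).Dom), Z.1 ⊆ X.1 →
      DifferentiableOn ℂ (fun z => ((S K) k).H hist (Φ K k X z) Z) (U K k X))
    (hΦemb : letI := θ.instVβ₁; letI := θ.instVβ₂; letI := θ.instιβ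
      ∀ K k X (B : Fin (F.P K).d → Site (F.P K) (k + 1) → θ.Vβ),
        Φ K k X (ιc K k X B) = emb K k (fun l t => NormedSpace.exp (θ.ρ8 (B l t))))
    (hΦsp : ∀ K k X, ∀ z ∈ U K k X, ∀ Z : (domSys (F.P K) M (k + 1)).Dom, Z.1 ⊆ X.1 → Φ K k X z ∈ sp K k Z)
    (w : (K k : ℕ) → (domSys (F.P K) M (k + 1)).Dom → Site (F.P K) (k + 1) → ℝ) (hw₀ : ∀ K k X t, 0 ≤ w K k X t)
    (hw : letI := θ.instVβ₁; letI := θ.instVβ₂; letI := θ.instιβ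
      ∀ K k X (l : Fin (F.P K).d) (t : Site (F.P K) (k + 1)) (c : θ.ιβ), ‖ιc K k X (Pi.single l (Pi.single t (θ.bV c)))‖ ≤ w K k X t)
    (hwB : ∀ K k (X : (domSys (F.P K) M (k + 1)).Dom) (t : Site (F.P K) (k + 1)),
      w K k X t ≤ B₃ * Real.exp (-δ₀ * distCT (domCount (F.P K) M (k + 1)) M (fun i => (ZMod.cast (t i) : ZMod (domCount (F.P K) M (k + 1) * M)))
        (nearT (M := M) (fun i => (ZMod.cast (t i) : ZMod (domCount (F.P K) M (k + 1) * M))) X)))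
    (lo : (k K : ℕ) → (domSys (F.P K) M (k + 1)).Dom → Prop) [∀ k K, DecidablePred (lo k K)]
    (hlo : ∀ (k K : ℕ) (X : (domSys (F.P K) M (k + 1)).Dom), ¬ lo k K X →
      let e : Site (F.P K) (k + 1) → TPt 4 (domCount (F.P K) M (k + 1) * M) := fun x i => (ZMod.cast (x i) : ZMod (domCount (F.P K) M (k + 1) * M))
      (K : ℝ) ≤ torusTreeLen X.1 ∨ (K : ℝ) ≤ distCT (domCount (F.P K) M (k + 1)) M (e (siteOfInt F K (k + 1) 0)) (nearT (M := M) (e (siteOfInt F K (k + 1) 0)) X))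
    (hr₀ : r₀ < 1) (hr₀' : 0 ≤ r₀) (hr₂ : 0 < r₂) (hr₂r : (2 * B₃ + 1) * r₂ ≤ r)
    (hG : letI := θ.instVβ₁; letI := θ.instVβ₂; letI := θ.instιβ
      ∀ g ∈ Window θ.γ, ∀ (k : ℕ) (μ ν : Fin 4) (z : Fin 4 → ℤ), ∃ (K₀ : ℕ) (C : ℝ), ∀ K : ℕ, K₀ ≤ K → ∀ (c : θ.ιβ) (σ : Fin 2 → ℂ), ‖σ‖ < r₂ →
      ‖∑ X ∈ Finset.univ.filter (lo k (K + 1)), ((S (K + 1)) k).E (histPrefix g k) (Φ (K + 1) k X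
          (σ 0 • ιc (K + 1) k X (Pi.single (Fin.cast (F.P_d (K + 1)).symm μ) (Pi.single (siteOfInt F (K + 1) (k + 1) z) (θ.bV c))) +
           σ 1 • ιc (K + 1) k X (Pi.single (Fin.cast (F.P_d (K + 1)).symm ν) (Pi.single (siteOfInt F (K + 1) (k + 1) 0) (θ.bV c))))) X -
        ∑ X ∈ Finset.univ.filter (lo k K), ((S K) k).E (histPrefix g k) (Φ K k X
          (σ 0 • ιc K k X (Pi.single (Fin.cast (F.P_d K).symm μ) (Pi.single (siteOfInt F K (k + 1) z) (θ.bV c))) +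
           σ 1 • ιc K k X (Pi.single (Fin.cast (F.P_d K).symm ν) (Pi.single (siteOfInt F K (k + 1) 0) (θ.bV c))))) X‖ ≤ C * r₀ ^ K) :
    PolLimitsExistOfRecord₁₃ F N θ := by
  letI := θ.instVβ₁; letI := θ.instVβ₂; letI := θ.instιβ
  exact (polLimitsExistOfRecord₁₃_iff_of_localizes F N θ S emb hloc).2
    (polLimitsExist_localizedSum_of_twoPointGenerating F m' M hM S emb θ.ρ8 θ.bV (Window θ.γ) Wk hWk sp hA hr₁ hκ0 hκ hκ4 hrate hsmall hB₃ hδ₀ hr h238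
      Ec ιc Φ U hU hrU hHhol hΦemb hΦsp w hw₀ hw hwB lo hlo hr₀ hr₀' hr₂ hr₂r hG)

end Record

/-! ## §4 A6 (director-ym №189): the hypotheses of §3 are JOINTLY INHABITED — at def-W1's TERMLESS TOWER (no (2.11) indices: `H ≡ 0`, `E ≡ 0`) and the ZERO PROBE CHART `ρ = 0` -/

section A6

variable {𝔄 : Type*} [NormedRing 𝔄] [NormedAlgebra ℝ 𝔄] {𝔸 : Type*}
variable {V : Type*} [NormedAddCommGroup V] [NormedSpace ℝ V] {ι : Type*} [Fintype ι]
variable (F : T4Family)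

open Classical in
/-- ★ **A6 — THE (G≈)-KEYED LETTER FIRES AT THE TERMLESS TOWER AND THE ZERO CHART.**  For every cube exponent `m′`, reading maps `emb`, basis `bV` and window `W`, ALL hypotheses of
`polLimitsExist_localizedSum_of_twoPointGenerating` hold SIMULTANEOUSLY for def-W1's termless towers `W1.termlessTower (F.P K) 𝔸 (L^{m′})` (every activity `H(Z) = 0`, so (2.38) holds with
amplitude `A := 0` and every (2.13) term vanishes, `W1.E_termlessTower`) at the zero probe chart `ρ := 0` (`ιc := 0`, `Φ :=` the constant reading `emb K k 1`, `U := univ`, `r := r₂ := 1`, weights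
`w := 0`, `B₃ := 0`, `δ₀ := 1`, `κ := r₁ := 4κ₀(64,8) + 1` by `kappa_four_smoke`, every domain «small», (G≈) with `C := 0`, `r₀ := 0` — both generating functions vanish identically) — and the
theorem YIELDS `PolLimitsExist F (localizedSum F termlessTower emb) 0 bV W`.  HONEST: a DEGENERATE model witness certifying only that the binder shapes (now with (G≈)) are jointly satisfiable
and the composition elaborates end to end; the NON-degenerate rung for the existence half needs cross-volume-coherent model towers the tree does not have (header); §3's record edition is LOCATED. -/
theorem polLimitsExist_localizedSum_of_twoPointGenerating_fires_zeroTower (m' : ℕ) [NeZero (F.L ^ m')]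
    (emb : ReadingMaps F 𝔄 𝔸) (bV : Module.Basis ι ℝ V) (W : Set (ℕ → ℝ)) :
    PolLimitsExist F (localizedSum F (fun K => termlessTower (F.P K) 𝔸 (F.L ^ m')) emb) (0 : V →L[ℝ] 𝔄) bV W := by
  have hH : ∀ (K k : ℕ) (hist : Fin (k + 1) → ℝ) (φ : CPair (F.P K) 𝔸) (Z : (domSys (F.P K) (F.L ^ m') (k + 1)).Dom),
      (termlessTower (F.P K) 𝔸 (F.L ^ m') k).H hist φ Z = 0 := fun K k hist φ Z => H_termlessTower k hist φ Z
  have hE : ∀ (K k : ℕ) (hist : Fin (k + 1) → ℝ) (φ : CPair (F.P K) 𝔸) (X : (domSys (F.P K) (F.L ^ m') (k + 1)).Dom),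
      (termlessTower (F.P K) 𝔸 (F.L ^ m') k).E hist φ X = 0 := fun K k hist φ X => E_termlessTower k hist φ X
  refine polLimitsExist_localizedSum_of_twoPointGenerating F m' (F.L ^ m') rfl _ emb 0 bV W (fun _ _ => Set.univ) (fun _ _ _ _ => Set.mem_univ _)
    (fun _ _ _ => Set.univ) (A := 0) (R := (4 * kappa₀ (4 * 2 ^ 4) (2 * 4) + 1) + 2 * (64 * Real.log 162) + 2) (r₁ := 4 * kappa₀ (4 * 2 ^ 4) (2 * 4) + 1)
    (κ := 4 * kappa₀ (4 * 2 ^ 4) (2 * 4) + 1) (B₃ := 0) (δ₀ := 1) (r := 1) (r₂ := 1) (r₀ := 0)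
    le_rfl (kappa_four_smoke).1.le (kappa_four_smoke).1 le_rfl (kappa_four_smoke).2 le_rfl (by simp) le_rfl one_pos one_pos
    (fun K k g _ Z φ _ => by rw [hH, norm_zero, zero_mul])
    (fun _ _ => ℂ) (fun K k _ => (0 : (Fin (F.P K).d → Site (F.P K) (k + 1) → V) →L[ℝ] ℂ)) (fun K k _ _ => emb K k (fun _ _ => 1)) (fun _ _ _ => Set.univ)
    (fun _ _ _ => isOpen_univ) (fun _ _ _ => Set.subset_univ _)
    (fun K k hist _ X Z _ => by simp only [hH]; exact differentiableOn_const 0)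
    (fun K k X B => by simp only [zero_apply, NormedSpace.exp_zero])
    (fun _ _ _ _ _ _ _ => Set.mem_univ _)
    (fun _ _ _ _ => 0) (fun _ _ _ _ => le_rfl) (fun _ _ _ _ _ _ => by rw [zero_apply, norm_zero]) (fun _ _ _ _ => by rw [zero_mul])
    (fun _ _ _ => True) (fun _ _ _ h => (h trivial).elim) zero_lt_one le_rfl one_pos (by norm_num)
    (fun g _ k μ ν z => ⟨0, 0, fun K _ c σ _ => by simp [hE]⟩)

end A6



/-! ## §5 THE ROW SENTENCES KEYED ON (G≈): p611742's `N22At` and (D4) read-out faces at a kernel-pinned reading of record, every run length, with (S≈) ↦ (G≈) -/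

section Row

open scoped Matrix.Norms.L2Operator

variable (F : T4Family) {N : ℕ} [NeZero N] {M : ℕ} [NeZero M]

open Classical in
/-- ★★★ **THE N22 ROW AT (β) KEYED ON THE VALUE-LEVEL LAW (G≈)**: p611742's `n22At_rateCarriers_of_kernels_pin_of_activitySlots_of_approxStable` — `N22At (rateCarriersOfRecord₁₃CoPH 𝔯 F θ hP g₀ os k).u3`
for EVERY `k` at a kernel-PINNED Stage-13 rate reading (`hpin` = K3⁷ v5's `U3PinnedKernels 𝔯 ℓ` at the tuple) from the law, W1's two activity slots at every tower∕level, the complexified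
readings with holomorphic activities and p. 282 tails, Road-1 numerals, `M = L^{m′}`, the small∕near class and the dominating letter block — with its kernel-level law (S≈) REPLACED by the
value-level (G≈) on the bidisc `‖σ‖ < r₂`, `(2B₃ + 1) r₂ ≤ r` (§2 `approxStable_of_twoPointGenerating` of the schema file, one application).  LOCATED (hypothesis form); N22 NOT discharged;
K3⁷ §2b `n22At_rrOfRecord_of_pinned` is this at the selector's value. [cite: Balaban1987RG1, (1.7) p.261, (1.18) p.263, (1.20)-(1.21) p.264, p.282; Balaban1988RG2Cluster, (2.13)-(2.14) pp.14-15, (2.38) p.20] -/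
theorem n22At_rateCarriers_of_kernels_pin_of_activitySlots_of_twoPointGenerating (𝔯 : RateReading₁₃CoPH N) (θ : Stage13HParams F N) (hP : θ.Provisos₁₃CoPH F N)
    (g₀ : ℕ → ℝ) (os : List (ULoop F)) (ℓ : U3Letters₁₁) (hs : ℓ.Signs) (hpin : (𝔯.lit F θ hP g₀ os).u3 = objectsOfRecord₁₃ F N θ.toStage13Params ℓ)
    (m' : ℕ) (hM : M = F.L ^ m')
    (S : (K : ℕ) → ClusterTower (F.P K) (MatA N) M) (emb : ReadingMaps F (MatA N) (MatA N)) (hloc : Localizes17OfRecord₁₃ F N θ.toStage13Params S emb)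
    (Wk : (K k : ℕ) → Set (Fin (k + 1) → ℝ)) (hWk : ∀ g ∈ Window θ.γ, ∀ K k, histPrefix g k ∈ Wk K k)
    (sp : (K k : ℕ) → (domSys (F.P K) M (k + 1)).Dom → Set (CPair (F.P K) (MatA N))) {A R r₁ κ B₃ δ₀ r r₂ r₀ : ℝ} (Λ : ℕ → ℕ → ℝ)
    (hA : 0 < A) (hr₁ : 0 ≤ r₁) (hκ0 : 0 < κ) (hκ : κ ≤ r₁) (hκ4 : kappa₀ (4 * 2 ^ 4) (2 * 4) ≤ κ / 2 / 2) (hrate : r₁ + 2 * (64 * Real.log 162) + 2 ≤ R)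
    (hsmall : 2 * A * Real.exp (5 * r₁ + 1) * K₀ 64 8 * 9 * 64 ≤ 1) (hΛ : ∀ k i, 0 ≤ Λ k i) (hB₃ : 0 ≤ B₃) (hδ₀ : 0 < δ₀) (hr : 0 < r)
    (h238 : ∀ K k, ((S K) k).Bound238 (Wk K k) (sp K k) A R)
    (hYL : ∀ K k, ((S K) k).YoungLipschitz (Wk K k) (sp K k) (fun i : Fin (k + 1) => Λ (k + 1) i) R)
    (Ec : ℕ → ℕ → Type*) [∀ K k, NormedAddCommGroup (Ec K k)] [∀ K k, NormedSpace ℂ (Ec K k)]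
    (ιc : letI := θ.instVβ₁; letI := θ.instVβ₂; letI := θ.instιβ
      (K k : ℕ) → (domSys (F.P K) M (k + 1)).Dom → ((Fin (F.P K).d → Site (F.P K) (k + 1) → θ.Vβ) →L[ℝ] Ec K k))
    (Φ : (K k : ℕ) → (domSys (F.P K) M (k + 1)).Dom → Ec K k → CPair (F.P K) (MatA N))
    (U : (K k : ℕ) → (domSys (F.P K) M (k + 1)).Dom → Set (Ec K k)) (hU : ∀ K k X, IsOpen (U K k X)) (hrU : ∀ K k X, ball (0 : Ec K k) r ⊆ U K k X)
    (hHhol : ∀ K k, ∀ hist ∈ Wk K k, ∀ (X Z : (domSys (F.P K) M (k + 1)).Dom), Z.1 ⊆ X.1 →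
      DifferentiableOn ℂ (fun z => ((S K) k).H hist (Φ K k X z) Z) (U K k X))
    (hΦemb : letI := θ.instVβ₁; letI := θ.instVβ₂; letI := θ.instιβ
      ∀ K k X (B : Fin (F.P K).d → Site (F.P K) (k + 1) → θ.Vβ),
        Φ K k X (ιc K k X B) = emb K k (fun l t => NormedSpace.exp (θ.ρ8 (B l t))))
    (hΦsp : ∀ K k X, ∀ z ∈ U K k X, ∀ Z : (domSys (F.P K) M (k + 1)).Dom, Z.1 ⊆ X.1 → Φ K k X z ∈ sp K k Z)
    (w : (K k : ℕ) → (domSys (F.P K) M (k + 1)).Dom → Site (F.P K) (k + 1) → ℝ) (hw₀ : ∀ K k X t, 0 ≤ w K k X t)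
    (hw : letI := θ.instVβ₁; letI := θ.instVβ₂; letI := θ.instιβ
      ∀ K k X (l : Fin (F.P K).d) (t : Site (F.P K) (k + 1)) (c : θ.ιβ), ‖ιc K k X (Pi.single l (Pi.single t (θ.bV c)))‖ ≤ w K k X t)
    (hwB : ∀ K k (X : (domSys (F.P K) M (k + 1)).Dom) (t : Site (F.P K) (k + 1)),
      w K k X t ≤ B₃ * Real.exp (-δ₀ * distCT (domCount (F.P K) M (k + 1)) M (fun i => (ZMod.cast (t i) : ZMod (domCount (F.P K) M (k + 1) * M)))
        (nearT (M := M) (fun i => (ZMod.cast (t i) : ZMod (domCount (F.P K) M (k + 1) * M))) X)))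
    (lo : (k K : ℕ) → (domSys (F.P K) M (k + 1)).Dom → Prop) [∀ k K, DecidablePred (lo k K)]
    (hlo : ∀ (k K : ℕ) (X : (domSys (F.P K) M (k + 1)).Dom), ¬ lo k K X →
      let e : Site (F.P K) (k + 1) → TPt 4 (domCount (F.P K) M (k + 1) * M) := fun x i => (ZMod.cast (x i) : ZMod (domCount (F.P K) M (k + 1) * M))
      (K : ℝ) ≤ torusTreeLen X.1 ∨ (K : ℝ) ≤ distCT (domCount (F.P K) M (k + 1)) M (e (siteOfInt F K (k + 1) 0)) (nearT (M := M) (e (siteOfInt F K (k + 1) 0)) X))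
    (hr₀ : r₀ < 1) (hr₀' : 0 ≤ r₀) (hr₂ : 0 < r₂) (hr₂r : (2 * B₃ + 1) * r₂ ≤ r)
    (hG : letI := θ.instVβ₁; letI := θ.instVβ₂; letI := θ.instιβ
      ∀ g ∈ Window θ.γ, ∀ (k : ℕ) (μ ν : Fin 4) (z : Fin 4 → ℤ), ∃ (K₀ : ℕ) (C : ℝ), ∀ K : ℕ, K₀ ≤ K → ∀ (c : θ.ιβ) (σ : Fin 2 → ℂ), ‖σ‖ < r₂ →
      ‖∑ X ∈ Finset.univ.filter (lo k (K + 1)), ((S (K + 1)) k).E (histPrefix g k) (Φ (K + 1) k X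
          (σ 0 • ιc (K + 1) k X (Pi.single (Fin.cast (F.P_d (K + 1)).symm μ) (Pi.single (siteOfInt F (K + 1) (k + 1) z) (θ.bV c))) +
           σ 1 • ιc (K + 1) k X (Pi.single (Fin.cast (F.P_d (K + 1)).symm ν) (Pi.single (siteOfInt F (K + 1) (k + 1) 0) (θ.bV c))))) X -
        ∑ X ∈ Finset.univ.filter (lo k K), ((S K) k).E (histPrefix g k) (Φ K k X
          (σ 0 • ιc K k X (Pi.single (Fin.cast (F.P_d K).symm μ) (Pi.single (siteOfInt F K (k + 1) z) (θ.bV c))) +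
           σ 1 • ιc K k X (Pi.single (Fin.cast (F.P_d K).symm ν) (Pi.single (siteOfInt F K (k + 1) 0) (θ.bV c))))) X‖ ≤ C * r₀ ^ K)
    (hℓκ : ℓ.κ ≤ delta1 δ₀ κ ((M : ℝ) * 4))
    (hdom : ∀ k i, (16 * (8 * (Real.exp 1 * 9 * 64 * K₀ 64 8 ^ 2)) * B₃ ^ 2 / r ^ 2) *
        Real.exp (delta1 δ₀ κ ((M : ℝ) * 4) * ((M : ℝ) * 4) * 3) * K₀ (4 * 2 ^ 4) (2 * 4) * K₁ 4 (δ₀ / 2) * Λ k i ≤ ℓ.moduli k i) (k : ℕ) :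
    N22At (rateCarriersOfRecord₁₃CoPH 𝔯 F θ hP g₀ os k).u3 :=
  letI := θ.instVβ₁; letI := θ.instVβ₂; letI := θ.instιβ
  n22At_rateCarriers_of_kernels_pin_of_activitySlots_of_approxStable F 𝔯 θ hP g₀ os ℓ hs hpin m' hM S emb hloc Wk hWk sp Λ hA hr₁ hκ0 hκ hκ4 hrate hsmall hΛ hB₃ hδ₀ hr h238
    hYL Ec ιc Φ U hU hrU hHhol hΦemb hΦsp w hw₀ hw hwB lo hlo hr₀ hr₀'
    (approxStable_of_twoPointGenerating F M S emb θ.ρ8 θ.bV (Window θ.γ) Wk hWk sp hA.le hr₁ hrate (numerals_of_doubled hA.le hκ0.le hκ4 hsmall).1 hB₃ hδ₀ hr h238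
      Ec ιc Φ U hU hrU hHhol hΦemb hΦsp w hw hwB lo hr₂ hr₂r hr₀' hG) hℓκ hdom k

open Classical in
/-- ★★★ **THE (D4) READ-OUT FACE KEYED ON (G≈)**: p611742's `readOutAt_rateCarriers_of_kernels_pin_of_activitySlots_of_approxStable` —
`ReadOutAt (datumOfRecord₁₃CoPH F N θ hP) (rateCarriersOfRecord₁₃CoPH 𝔯 F θ hP g₀ os k).u3` for every `k` under the pin, the letter rows `0 < ℓ.κ ≤ δ₁`, `betaPrime510 4 1 ℓ.κ ≤ ℓ.cr`, the law, W1's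
(2.38) value slot, the complexified readings, tails, Road-1 numerals, the small∕near class — with (S≈) REPLACED by (G≈) (one application of `approxStable_of_twoPointGenerating`; dag-n27-w1's
`readOutAt_objectsOfRecord₁₃_coPH` p591653 inside).  LOCATED; (D4) NOT discharged. [cite: Balaban1987RG1, (1.20)-(1.21) p.264, (5.10) p.293; Balaban1988RG2Cluster, (2.13)-(2.14) pp.14-15, (2.38) p.20] -/
theorem readOutAt_rateCarriers_of_kernels_pin_of_activitySlots_of_twoPointGenerating (𝔯 : RateReading₁₃CoPH N) (θ : Stage13HParams F N) (hP : θ.Provisos₁₃CoPH F N)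
    (g₀ : ℕ → ℝ) (os : List (ULoop F)) (ℓ : U3Letters₁₁) (hs : ℓ.Signs) (hℓ₀ : 0 < ℓ.κ) (hcr : betaPrime510 4 1 ℓ.κ ≤ ℓ.cr)
    (hpin : (𝔯.lit F θ hP g₀ os).u3 = objectsOfRecord₁₃ F N θ.toStage13Params ℓ)
    (m' : ℕ) (hM : M = F.L ^ m')
    (S : (K : ℕ) → ClusterTower (F.P K) (MatA N) M) (emb : ReadingMaps F (MatA N) (MatA N)) (hloc : Localizes17OfRecord₁₃ F N θ.toStage13Params S emb)
    (Wk : (K k : ℕ) → Set (Fin (k + 1) → ℝ)) (hWk : ∀ g ∈ Window θ.γ, ∀ K k, histPrefix g k ∈ Wk K k)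
    (sp : (K k : ℕ) → (domSys (F.P K) M (k + 1)).Dom → Set (CPair (F.P K) (MatA N))) {A R r₁ κ B₃ δ₀ r r₂ r₀ : ℝ}
    (hA : 0 ≤ A) (hr₁ : 0 ≤ r₁) (hκ0 : 0 < κ) (hκ : κ ≤ r₁) (hκ4 : kappa₀ (4 * 2 ^ 4) (2 * 4) ≤ κ / 2 / 2) (hrate : r₁ + 2 * (64 * Real.log 162) + 2 ≤ R)
    (hsmall : A * Real.exp (5 * r₁ + 1) * K₀ 64 8 * 9 * 64 ≤ 1) (hB₃ : 0 ≤ B₃) (hδ₀ : 0 < δ₀) (hr : 0 < r)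
    (h238 : ∀ K k, ((S K) k).Bound238 (Wk K k) (sp K k) A R)
    (Ec : ℕ → ℕ → Type*) [∀ K k, NormedAddCommGroup (Ec K k)] [∀ K k, NormedSpace ℂ (Ec K k)]
    (ιc : letI := θ.instVβ₁; letI := θ.instVβ₂; letI := θ.instιβ
      (K k : ℕ) → (domSys (F.P K) M (k + 1)).Dom → ((Fin (F.P K).d → Site (F.P K) (k + 1) → θ.Vβ) →L[ℝ] Ec K k))
    (Φ : (K k : ℕ) → (domSys (F.P K) M (k + 1)).Dom → Ec K k → CPair (F.P K) (MatA N))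
    (U : (K k : ℕ) → (domSys (F.P K) M (k + 1)).Dom → Set (Ec K k)) (hU : ∀ K k X, IsOpen (U K k X)) (hrU : ∀ K k X, ball (0 : Ec K k) r ⊆ U K k X)
    (hHhol : ∀ K k, ∀ hist ∈ Wk K k, ∀ (X Z : (domSys (F.P K) M (k + 1)).Dom), Z.1 ⊆ X.1 →
      DifferentiableOn ℂ (fun z => ((S K) k).H hist (Φ K k X z) Z) (U K k X))
    (hΦemb : letI := θ.instVβ₁; letI := θ.instVβ₂; letI := θ.instιβ
      ∀ K k X (B : Fin (F.P K).d → Site (F.P K) (k + 1) → θ.Vβ),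
        Φ K k X (ιc K k X B) = emb K k (fun l t => NormedSpace.exp (θ.ρ8 (B l t))))
    (hΦsp : ∀ K k X, ∀ z ∈ U K k X, ∀ Z : (domSys (F.P K) M (k + 1)).Dom, Z.1 ⊆ X.1 → Φ K k X z ∈ sp K k Z)
    (w : (K k : ℕ) → (domSys (F.P K) M (k + 1)).Dom → Site (F.P K) (k + 1) → ℝ) (hw₀ : ∀ K k X t, 0 ≤ w K k X t)
    (hw : letI := θ.instVβ₁; letI := θ.instVβ₂; letI := θ.instιβ
      ∀ K k X (l : Fin (F.P K).d) (t : Site (F.P K) (k + 1)) (c : θ.ιβ), ‖ιc K k X (Pi.single l (Pi.single t (θ.bV c)))‖ ≤ w K k X t)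
    (hwB : ∀ K k (X : (domSys (F.P K) M (k + 1)).Dom) (t : Site (F.P K) (k + 1)),
      w K k X t ≤ B₃ * Real.exp (-δ₀ * distCT (domCount (F.P K) M (k + 1)) M (fun i => (ZMod.cast (t i) : ZMod (domCount (F.P K) M (k + 1) * M)))
        (nearT (M := M) (fun i => (ZMod.cast (t i) : ZMod (domCount (F.P K) M (k + 1) * M))) X)))
    (lo : (k K : ℕ) → (domSys (F.P K) M (k + 1)).Dom → Prop) [∀ k K, DecidablePred (lo k K)]
    (hlo : ∀ (k K : ℕ) (X : (domSys (F.P K) M (k + 1)).Dom), ¬ lo k K X →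
      let e : Site (F.P K) (k + 1) → TPt 4 (domCount (F.P K) M (k + 1) * M) := fun x i => (ZMod.cast (x i) : ZMod (domCount (F.P K) M (k + 1) * M))
      (K : ℝ) ≤ torusTreeLen X.1 ∨ (K : ℝ) ≤ distCT (domCount (F.P K) M (k + 1)) M (e (siteOfInt F K (k + 1) 0)) (nearT (M := M) (e (siteOfInt F K (k + 1) 0)) X))
    (hr₀ : r₀ < 1) (hr₀' : 0 ≤ r₀) (hr₂ : 0 < r₂) (hr₂r : (2 * B₃ + 1) * r₂ ≤ r)
    (hG : letI := θ.instVβ₁; letI := θ.instVβ₂; letI := θ.instιβ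
      ∀ g ∈ Window θ.γ, ∀ (k : ℕ) (μ ν : Fin 4) (z : Fin 4 → ℤ), ∃ (K₀ : ℕ) (C : ℝ), ∀ K : ℕ, K₀ ≤ K → ∀ (c : θ.ιβ) (σ : Fin 2 → ℂ), ‖σ‖ < r₂ →
      ‖∑ X ∈ Finset.univ.filter (lo k (K + 1)), ((S (K + 1)) k).E (histPrefix g k) (Φ (K + 1) k X
          (σ 0 • ιc (K + 1) k X (Pi.single (Fin.cast (F.P_d (K + 1)).symm μ) (Pi.single (siteOfInt F (K + 1) (k + 1) z) (θ.bV c))) +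
           σ 1 • ιc (K + 1) k X (Pi.single (Fin.cast (F.P_d (K + 1)).symm ν) (Pi.single (siteOfInt F (K + 1) (k + 1) 0) (θ.bV c))))) X -
        ∑ X ∈ Finset.univ.filter (lo k K), ((S K) k).E (histPrefix g k) (Φ K k X
          (σ 0 • ιc K k X (Pi.single (Fin.cast (F.P_d K).symm μ) (Pi.single (siteOfInt F K (k + 1) z) (θ.bV c))) +
           σ 1 • ιc K k X (Pi.single (Fin.cast (F.P_d K).symm ν) (Pi.single (siteOfInt F K (k + 1) 0) (θ.bV c))))) X‖ ≤ C * r₀ ^ K)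
    (hℓκ : ℓ.κ ≤ delta1 δ₀ κ ((M : ℝ) * 4)) (k : ℕ) :
    ReadOutAt (datumOfRecord₁₃CoPH F N θ hP) (rateCarriersOfRecord₁₃CoPH 𝔯 F θ hP g₀ os k).u3 :=
  letI := θ.instVβ₁; letI := θ.instVβ₂; letI := θ.instιβ
  readOutAt_rateCarriers_of_kernels_pin_of_activitySlots_of_approxStable F 𝔯 θ hP g₀ os ℓ hs hℓ₀ hcr hpin m' hM S emb hloc Wk hWk sp hA hr₁ hκ0 hκ hκ4 hrate hsmall hB₃ hδ₀ hr
    h238 Ec ιc Φ U hU hrU hHhol hΦemb hΦsp w hw₀ hw hwB lo hlo hr₀ hr₀'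
    (approxStable_of_twoPointGenerating F M S emb θ.ρ8 θ.bV (Window θ.γ) Wk hWk sp hA hr₁ hrate hsmall hB₃ hδ₀ hr h238
      Ec ιc Φ U hU hrU hHhol hΦemb hΦsp w hw hwB lo hr₂ hr₂r hr₀' hG) hℓκ k

end Row

end YMDAG.N22.AtKernels

end
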